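import Summits.QuantumAdvantage.QuantumAdvantage.Theorems.CharDialTowerA
import Summits.QuantumAdvantage.QuantumAdvantage.Theorems.CharDialBlockDialE
import Summits.QuantumAdvantage.AdviceFreeQNC0.PredHard
import HarnessLib

/-!
# CharDial / JLinPeel — THE DIAL TOWER, part B: the BLOCK dial absorbed into the residual on both sides, BY NAME
(route `CharDial`, item 32604; lens-6 node g17 REV13–REV14 / g18 §11.3 land-port)

* `BlockHyp D` — the block-dial hypothesis with the threshold explicit in `n, p`: `M ≥ 2^p·((log₂ n+1)²+1)` pairwise separated `p`-blocks
  `[S k, S k + p)` on each of which every form is constant (stated inline, matching `BlockDial.blockDial_hard`); `mod3_of_prime_ge5`.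
* ★ `blockDialLog_hard (p) (3 ∤ p)` — the block dial DECIDED for juntas `≤ log₂ n` (= `BlockDial.blockDial_hard`); `blockHyp_of_aligned` (the aligned
  family inhabits it), `alignedBlock_hard'` (consistency).
* `ResidualHigh3Side B`; ★ `residualHighSide_iff_residualHigh3`, ★ `walkHardFJLinOdd_iff_low_and_residualHigh3`, `walkHardFJLinOdd_iff_sharpened3`.
* the SYMMETRIC PEEL: `dials_absorb` (rank + sparse + block dial + a residual bound on a variation class `V` ⇒ the bound on all of `V`), `Residual3Side`
  (★ `walkHardFJLinOdd_iff_residual3`), `LowResidual3Side B` (★ `lowSide_iff_lowResidual3`), ★ `highSide_iff_residualHigh3`,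
  ★ `walkHardFJLinOdd_iff_residual3_split (B) : T ↔ LowResidual3Side B ∧ ResidualHigh3Side B`, `walkHardFJLinOdd_iff_sharpened4`, projections.

0 sorry.
-/

set_option autoImplicit false

namespace Summit.QuantumAdvantage.AdviceFreeQNC0.JLinPeel.Tower

open Finset

variable {n : ℕ}

section BlockResidual

variable {p : ℕ}

/-- the BLOCK DIAL hypothesis on a presentation (threshold explicit in `n, p`): there are `M ≥ 2^p·((log₂ n + 1)² + 1)` pairwise separated
blocks `[S k, S k + p) ⊆ {0,…,n−1}` on each of which every form `D.a g` is constant. -/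
def BlockHyp (D : JLinPeel.JLinData p n) : Prop :=
  ∃ (M : ℕ) (S : Fin M → ℕ), ((∀ k k' : Fin M, k < k' → S k + p ≤ S k') ∧ (∀ k : Fin M, S k + p ≤ n)) ∧
    2 ^ p * ((Nat.log 2 n + 1) * (Nat.log 2 n + 1) + 1) ≤ M ∧
      ∀ g (k : Fin M) (i i' : Fin n), (S k ≤ i.val ∧ i.val < S k + p) → (S k ≤ i'.val ∧ i'.val < S k + p) → D.a g i = D.a g i'

/-- primes `p ≥ 5` are `≢ 0 (mod 3)`. -/
theorem mod3_of_prime_ge5 (hp : p.Prime) (h5 : 5 ≤ p) : p % 3 = 1 ∨ p % 3 = 2 := by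
  have h3 : ¬ 3 ∣ p := by
    intro h
    rcases Nat.Prime.eq_one_or_self_of_dvd hp 3 h with h1 | h1 <;> omega
  omega

/-- ★ **the block dial in the summit's format**: for `3 ∤ p` there are `θ < 1` and `n₀` such that for all `n ≥ n₀` every presentation with
juntas `≤ log₂ n` satisfying `BlockHyp` wins on at most `θ·2ⁿ` inputs (tables arbitrary). -/
theorem blockDialLog_hard (p : ℕ) (hp3 : p % 3 = 1 ∨ p % 3 = 2) :
    ∃ θ : ℝ, θ < 1 ∧ ∃ n₀ : ℕ, ∀ n ≥ n₀, ∀ (c : ℕ) (D : JLinPeel.JLinData p n),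
      (∀ g, (D.J g).card ≤ Nat.log 2 n) → BlockHyp D →
        ((Finset.univ.filter fun u : Fin n → Bool => ringWinU c D.strat u = true).card : ℝ) ≤ θ * (2 : ℝ) ^ n := by
  obtain ⟨θ, hθ, N₁, hN⟩ := BlockDial.blockDial_hard p hp3
  refine ⟨θ, hθ, 2 ^ N₁, fun n hn c D hJ hB => ?_⟩
  obtain ⟨M, S, hS, hM, hconst⟩ := hB
  have hlog : N₁ ≤ Nat.log 2 n := by
    have h := Nat.log_mono_right (b := 2) hn
    rwa [Nat.log_pow (by norm_num : 1 < 2)] at h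
  have h1 : 2 ^ p * (N₁ + 1) ≤ M :=
    le_trans (Nat.mul_le_mul_left _ (by nlinarith)) hM
  exact hN n M (Nat.log 2 n) S hS h1 hM c D hJ hconst

/-- **the ALIGNED family inhabits the block dial**: for `n ≥ n₀(p)`, forms depending only on `⌊i/p⌋` satisfy `BlockHyp` (blocks
`{kp,…,kp+p−1}`, `k < n/p`; `n/p ≥ 2^p·((log₂ n+1)²+1)` eventually). -/
theorem blockHyp_of_aligned (p : ℕ) (hp : 1 ≤ p) :
    ∃ n₀ : ℕ, ∀ n ≥ n₀, ∀ D : JLinPeel.JLinData p n,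
      (∀ g (i i' : Fin n), i.val / p = i'.val / p → D.a g i = D.a g i') → BlockHyp D := by
  obtain ⟨m₀, hm₀⟩ := DWalk.const_mul_logPow_le' (p * 2 ^ p * 5) 2
  refine ⟨max m₀ 4, fun n hn D hconst => ?_⟩
  have hn₀ : m₀ ≤ n := le_trans (le_max_left _ _) hn
  have hn4 : 4 ≤ n := le_trans (le_max_right _ _) hn
  have hlog := hm₀ n hn₀
  have hlog1 : 1 ≤ Nat.log 2 n := Nat.log_pos (by norm_num) (by omega)
  refine ⟨n / p, fun k => k.val * p, ⟨fun k k' hkk => ?_, fun k => ?_⟩, ?_, ?_⟩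
  · show k.val * p + p ≤ k'.val * p
    have hlt : k.val + 1 ≤ k'.val := hkk
    nlinarith
  · show k.val * p + p ≤ n
    have hk : k.val + 1 ≤ n / p := k.isLt
    have := (Nat.le_div_iff_mul_le hp).mp hk
    nlinarith
  · refine (Nat.le_div_iff_mul_le hp).mpr ?_
    have h5 : (Nat.log 2 n + 1) * (Nat.log 2 n + 1) + 1 ≤ 5 * Nat.log 2 n ^ 2 := by nlinarith [hlog1]
    calc 2 ^ p * ((Nat.log 2 n + 1) * (Nat.log 2 n + 1) + 1) * p ≤ 2 ^ p * (5 * Nat.log 2 n ^ 2) * p :=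
          Nat.mul_le_mul_right _ (Nat.mul_le_mul_left _ h5)
      _ = p * 2 ^ p * 5 * Nat.log 2 n ^ 2 := by ring
      _ ≤ n := hlog
  · intro g k i i' hi hi'
    apply hconst
    have hdiv : ∀ j : Fin n, (k.val * p ≤ j.val ∧ j.val < k.val * p + p) → j.val / p = k.val := by
      intro j hj
      have h1 : k.val ≤ j.val / p := (Nat.le_div_iff_mul_le hp).mpr hj.1
      have h2 : j.val / p < k.val + 1 := by
        refine (Nat.div_lt_iff_lt_mul hp).mpr ?_
        have h' : j.val < k.val * p + p := hj.2
        rw [add_mul, one_mul]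
        exact h'
      omega
    rw [hdiv i hi, hdiv i' hi']

/-- the summit-format block dial recovers `BlockDial.alignedBlock_hard` (consistency check of the two thresholds). -/
theorem alignedBlock_hard' (p : ℕ) (hp3 : p % 3 = 1 ∨ p % 3 = 2) :
    ∃ θ : ℝ, θ < 1 ∧ ∃ n₀ : ℕ, ∀ n ≥ n₀, ∀ (c : ℕ) (D : JLinPeel.JLinData p n), (∀ g, (D.J g).card ≤ Nat.log 2 n) →
      (∀ g (i i' : Fin n), i.val / p = i'.val / p → D.a g i = D.a g i') →
      ((Finset.univ.filter fun u : Fin n → Bool => ringWinU c D.strat u = true).card : ℝ) ≤ θ * (2 : ℝ) ^ n := by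
  obtain ⟨θ, hθ, n₁, h₁⟩ := blockDialLog_hard p hp3
  obtain ⟨n₂, h₂⟩ := blockHyp_of_aligned p (by omega)
  exact ⟨θ, hθ, max n₁ n₂, fun n hn c D hJ hconst =>
    h₁ n (le_trans (le_max_left _ _) hn) c D hJ (h₂ n (le_trans (le_max_right _ _) hn) D hconst)⟩

/-- **piece RESIDUAL-HIGH‴ (REV13).** `WalkHardFJLinOdd` restricted to HIGH-variation strategies all of whose `log₂ n`-junta ⊕ form presentations
escape the rank dial, the sparse-free-set dial AND the block dial. -/
def ResidualHigh3Side (B : ℕ → ℕ) : Prop :=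
  ∀ (p : ℕ) [Fact p.Prime], 5 ≤ p → ∃ θ : ℝ, θ < 1 ∧ ∃ n₀ : ℕ, ∀ n ≥ n₀, ∀ c : ℕ,
    ∀ y : Fin (n + 1) → (Fin n → Bool) → Bool, JLinHyp p n y → ¬ LowVar B n y →
      (∀ D : JLinPeel.JLinData p n, D.strat = y → (∀ g, (D.J g).card ≤ Nat.log 2 n) →
          ¬ SpanHyp D ∧ ¬ SparseHyp D ∧ ¬ BlockHyp D) →
        ((Finset.univ.filter fun u : Fin n → Bool => ringWinU c y u = true).card : ℝ) ≤ θ * (2 : ℝ) ^ n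

/-- RESIDUAL-HIGH implies RESIDUAL-HIGH‴ (projection). -/
theorem residualHigh3Side_of_residualHighSide (B : ℕ → ℕ) (h : ResidualHighSide B) : ResidualHigh3Side B := by
  intro p _ hp
  obtain ⟨θ, hθ, n₀, hn₀⟩ := h p hp
  exact ⟨θ, hθ, n₀, fun n hn c y hy hv hesc =>
    hn₀ n hn c y hy hv fun D hDy hJ => ⟨(hesc D hDy hJ).1, (hesc D hDy hJ).2.1⟩⟩

/-- ★ **RESIDUAL-HIGH ⟺ RESIDUAL-HIGH‴** (every schedule): the block dial is absorbed. -/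
theorem residualHighSide_iff_residualHigh3 (B : ℕ → ℕ) : ResidualHighSide B ↔ ResidualHigh3Side B := by
  refine ⟨residualHigh3Side_of_residualHighSide B, fun hR p _ hp => ?_⟩
  have hp3 : p % 3 = 1 ∨ p % 3 = 2 := mod3_of_prime_ge5 Fact.out hp
  obtain ⟨θ₂, hθ₂, n₂, h₂⟩ := blockDialLog_hard p hp3
  obtain ⟨θ₄, hθ₄, n₄, h₄⟩ := hR p hp
  refine ⟨max θ₂ θ₄, max_lt hθ₂ hθ₄, max n₂ n₄, fun n hn c y hy hv hesc => ?_⟩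
  have hpow : (0 : ℝ) ≤ (2 : ℝ) ^ n := by positivity
  have hn2 : n₂ ≤ n := le_trans (le_max_left _ _) hn
  have hn4 : n₄ ≤ n := le_trans (le_max_right _ _) hn
  by_cases hblk : ∃ D : JLinPeel.JLinData p n, D.strat = y ∧ (∀ g, (D.J g).card ≤ Nat.log 2 n) ∧ BlockHyp D
  · obtain ⟨D, hDy, hJ, hB⟩ := hblk
    rw [← hDy]
    exact le_trans (h₂ n hn2 c D hJ hB) (mul_le_mul_of_nonneg_right (le_max_left _ _) hpow)
  · have hesc3 : ∀ D : JLinPeel.JLinData p n, D.strat = y → (∀ g, (D.J g).card ≤ Nat.log 2 n) →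
        ¬ SpanHyp D ∧ ¬ SparseHyp D ∧ ¬ BlockHyp D := fun D hDy hJ =>
      ⟨(hesc D hDy hJ).1, (hesc D hDy hJ).2, fun hB => hblk ⟨D, hDy, hJ, hB⟩⟩
    exact le_trans (h₄ n hn4 c y hy hv hesc3) (mul_le_mul_of_nonneg_right (le_max_right _ _) hpow)

/-- ★ **JUNCTION 4 (proved, by name): T ⟺ LOW ∧ RESIDUAL-HIGH‴** for every threshold schedule `B` — three decided dials peeled off the
HIGH side. -/
theorem walkHardFJLinOdd_iff_low_and_residualHigh3 (B : ℕ → ℕ) :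
    Summit.QuantumAdvantage.QuantumAdvantage.Theses.CharDial.WalkHardFJLinOdd ↔ LowSide B ∧ ResidualHigh3Side B := by
  rw [walkHardFJLinOdd_iff_low_and_residualHigh B, residualHighSide_iff_residualHigh3 B]

/-- the typed pieces of this node after REV13, by name: T ⟺ LOW(dialB) ∧ RESIDUAL-HIGH‴(dialB). -/
theorem walkHardFJLinOdd_iff_sharpened3 :
    Summit.QuantumAdvantage.QuantumAdvantage.Theses.CharDial.WalkHardFJLinOdd ↔ LowSide dialB ∧ ResidualHigh3Side dialB :=
  walkHardFJLinOdd_iff_low_and_residualHigh3 dialB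

/-- T implies RESIDUAL-HIGH‴ (projection; recorded so the piece is visibly WEAKER-or-equal). -/
theorem residualHigh3Side_of_walkHardFJLinOdd (B : ℕ → ℕ)
    (hT : Summit.QuantumAdvantage.QuantumAdvantage.Theses.CharDial.WalkHardFJLinOdd) : ResidualHigh3Side B :=
  ((walkHardFJLinOdd_iff_low_and_residualHigh3 B).mp hT).2

end BlockResidual

section BlockResidual2

variable {p : ℕ}

/-- **ABSORPTION.** the three decided dials plus a residual bound on a variation class `V` give the bound on ALL hypothesis-satisfying
strategies of `V` (case split on «some `log₂ n`-junta presentation meets a dial»). -/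
theorem dials_absorb (p : ℕ) [Fact p.Prime] (hp : 5 ≤ p) (V : ∀ n : ℕ, (Fin (n + 1) → (Fin n → Bool) → Bool) → Prop)
    (hR : ∃ θ : ℝ, θ < 1 ∧ ∃ n₀ : ℕ, ∀ n ≥ n₀, ∀ c : ℕ, ∀ y : Fin (n + 1) → (Fin n → Bool) → Bool, JLinHyp p n y → V n y →
      (∀ D : JLinPeel.JLinData p n, D.strat = y → (∀ g, (D.J g).card ≤ Nat.log 2 n) →
          ¬ SpanHyp D ∧ ¬ SparseHyp D ∧ ¬ BlockHyp D) →
        ((Finset.univ.filter fun u : Fin n → Bool => ringWinU c y u = true).card : ℝ) ≤ θ * (2 : ℝ) ^ n) :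
    ∃ θ : ℝ, θ < 1 ∧ ∃ n₀ : ℕ, ∀ n ≥ n₀, ∀ c : ℕ, ∀ y : Fin (n + 1) → (Fin n → Bool) → Bool, JLinHyp p n y → V n y →
      ((Finset.univ.filter fun u : Fin n → Bool => ringWinU c y u = true).card : ℝ) ≤ θ * (2 : ℝ) ^ n := by
  obtain ⟨θ₁, hθ₁, n₁, h₁⟩ := spanDial_hard p hp
  obtain ⟨θ₂, hθ₂, n₂, h₂⟩ := sparseDial_hard p
  obtain ⟨θ₃, hθ₃, n₃, h₃⟩ := blockDialLog_hard p (mod3_of_prime_ge5 Fact.out hp)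
  obtain ⟨θ₄, hθ₄, n₄, h₄⟩ := hR
  refine ⟨max (max θ₁ θ₂) (max θ₃ θ₄), max_lt (max_lt hθ₁ hθ₂) (max_lt hθ₃ hθ₄),
    max (max n₁ n₂) (max n₃ n₄), fun n hn c y hy hV => ?_⟩
  have hpow : (0 : ℝ) ≤ (2 : ℝ) ^ n := by positivity
  have hn1 : n₁ ≤ n := le_trans (le_trans (le_max_left _ _) (le_max_left _ _)) hn
  have hn2 : n₂ ≤ n := le_trans (le_trans (le_max_right _ _) (le_max_left _ _)) hn
  have hn3 : n₃ ≤ n := le_trans (le_trans (le_max_left _ _) (le_max_right _ _)) hn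
  have hn4 : n₄ ≤ n := le_trans (le_trans (le_max_right _ _) (le_max_right _ _)) hn
  have hθ1 : θ₁ ≤ max (max θ₁ θ₂) (max θ₃ θ₄) := le_trans (le_max_left _ _) (le_max_left _ _)
  have hθ2 : θ₂ ≤ max (max θ₁ θ₂) (max θ₃ θ₄) := le_trans (le_max_right _ _) (le_max_left _ _)
  have hθ3 : θ₃ ≤ max (max θ₁ θ₂) (max θ₃ θ₄) := le_trans (le_max_left _ _) (le_max_right _ _)
  have hθ4 : θ₄ ≤ max (max θ₁ θ₂) (max θ₃ θ₄) := le_trans (le_max_right _ _) (le_max_right _ _)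
  by_cases hdial : ∃ D : JLinPeel.JLinData p n, D.strat = y ∧ (∀ g, (D.J g).card ≤ Nat.log 2 n) ∧
      (SpanHyp D ∨ SparseHyp D ∨ BlockHyp D)
  · obtain ⟨D, hDy, hJ, hS | hS | hS⟩ := hdial
    · rw [← hDy]
      exact le_trans (h₁ n hn1 c D hJ hS) (mul_le_mul_of_nonneg_right hθ1 hpow)
    · rw [← hDy]
      exact le_trans (h₂ n hn2 c D hS) (mul_le_mul_of_nonneg_right hθ2 hpow)
    · rw [← hDy]
      exact le_trans (h₃ n hn3 c D hJ hS) (mul_le_mul_of_nonneg_right hθ3 hpow)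
  · have hesc : ∀ D : JLinPeel.JLinData p n, D.strat = y → (∀ g, (D.J g).card ≤ Nat.log 2 n) →
        ¬ SpanHyp D ∧ ¬ SparseHyp D ∧ ¬ BlockHyp D := fun D hDy hJ =>
      ⟨fun hS => hdial ⟨D, hDy, hJ, Or.inl hS⟩, fun hS => hdial ⟨D, hDy, hJ, Or.inr (Or.inl hS)⟩,
        fun hS => hdial ⟨D, hDy, hJ, Or.inr (Or.inr hS)⟩⟩
    exact le_trans (h₄ n hn4 c y hy hV hesc) (mul_le_mul_of_nonneg_right hθ4 hpow)

/-- **the THREE-DIAL RESIDUAL of T** (no variation condition): `WalkHardFJLinOdd` restricted to strategies all of whose `log₂ n`-junta ⊕ form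
presentations escape the rank dial, the sparse dial and the block dial. -/
def Residual3Side : Prop :=
  ∀ (p : ℕ) [Fact p.Prime], 5 ≤ p → ∃ θ : ℝ, θ < 1 ∧ ∃ n₀ : ℕ, ∀ n ≥ n₀, ∀ c : ℕ,
    ∀ y : Fin (n + 1) → (Fin n → Bool) → Bool, JLinHyp p n y →
      (∀ D : JLinPeel.JLinData p n, D.strat = y → (∀ g, (D.J g).card ≤ Nat.log 2 n) →
          ¬ SpanHyp D ∧ ¬ SparseHyp D ∧ ¬ BlockHyp D) →
        ((Finset.univ.filter fun u : Fin n → Bool => ringWinU c y u = true).card : ℝ) ≤ θ * (2 : ℝ) ^ n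

/-- ★ **JUNCTION 5 (proved, by name): T ⟺ its three-dial residual.** -/
theorem walkHardFJLinOdd_iff_residual3 :
    Summit.QuantumAdvantage.QuantumAdvantage.Theses.CharDial.WalkHardFJLinOdd ↔ Residual3Side := by
  constructor
  · intro hT p _ hp
    obtain ⟨θ, hθ, n₀, hn₀⟩ := hT p hp
    exact ⟨θ, hθ, n₀, fun n hn c y hy _ => hn₀ n hn c y hy⟩
  · intro hR p _ hp
    obtain ⟨θ, hθ, n₀, hn₀⟩ := dials_absorb p hp (fun _ _ => True)
      (by
        obtain ⟨θ, hθ, n₀, hn₀⟩ := hR p hp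
        exact ⟨θ, hθ, n₀, fun n hn c y hy _ hesc => hn₀ n hn c y hy hesc⟩)
    exact ⟨θ, hθ, n₀, fun n hn c y hy => hn₀ n hn c y hy trivial⟩

/-- **piece LOW-RESIDUAL‴.** `WalkHardFJLinOdd` restricted to LOW-variation strategies all of whose `log₂ n`-junta presentations escape the three
decided dials. -/
def LowResidual3Side (B : ℕ → ℕ) : Prop :=
  ∀ (p : ℕ) [Fact p.Prime], 5 ≤ p → ∃ θ : ℝ, θ < 1 ∧ ∃ n₀ : ℕ, ∀ n ≥ n₀, ∀ c : ℕ,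
    ∀ y : Fin (n + 1) → (Fin n → Bool) → Bool, JLinHyp p n y → LowVar B n y →
      (∀ D : JLinPeel.JLinData p n, D.strat = y → (∀ g, (D.J g).card ≤ Nat.log 2 n) →
          ¬ SpanHyp D ∧ ¬ SparseHyp D ∧ ¬ BlockHyp D) →
        ((Finset.univ.filter fun u : Fin n → Bool => ringWinU c y u = true).card : ℝ) ≤ θ * (2 : ℝ) ^ n

/-- ★ **LOW ⟺ LOW-RESIDUAL‴** (every schedule): the three dials are absorbed on the LOW side too. -/
theorem lowSide_iff_lowResidual3 (B : ℕ → ℕ) : LowSide B ↔ LowResidual3Side B := by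
  constructor
  · intro hL p _ hp
    obtain ⟨θ, hθ, n₀, hn₀⟩ := hL p hp
    exact ⟨θ, hθ, n₀, fun n hn c y hy hv _ => hn₀ n hn c y hy hv⟩
  · intro hR p _ hp
    exact dials_absorb p hp (fun n y => LowVar B n y) (hR p hp)

/-- ★ **HIGH ⟺ RESIDUAL-HIGH‴** directly (every schedule). -/
theorem highSide_iff_residualHigh3 (B : ℕ → ℕ) : HighSide B ↔ ResidualHigh3Side B := by
  rw [highSide_iff_residualHigh B, residualHighSide_iff_residualHigh3 B]

/-- ★ **JUNCTION 6 (proved, by name): T ⟺ LOW-RESIDUAL‴ ∧ RESIDUAL-HIGH‴** — the variation split with all three decided dials peeled off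
BOTH sides (every schedule `B`). -/
theorem walkHardFJLinOdd_iff_residual3_split (B : ℕ → ℕ) :
    Summit.QuantumAdvantage.QuantumAdvantage.Theses.CharDial.WalkHardFJLinOdd ↔ LowResidual3Side B ∧ ResidualHigh3Side B := by
  rw [walkHardFJLinOdd_iff_low_and_residualHigh3 B, lowSide_iff_lowResidual3 B]

/-- the typed pieces of this node after REV14, by name: T ⟺ LOW-RESIDUAL‴(dialB) ∧ RESIDUAL-HIGH‴(dialB). -/
theorem walkHardFJLinOdd_iff_sharpened4 :
    Summit.QuantumAdvantage.QuantumAdvantage.Theses.CharDial.WalkHardFJLinOdd ↔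
      LowResidual3Side dialB ∧ ResidualHigh3Side dialB :=
  walkHardFJLinOdd_iff_residual3_split dialB

/-- projections: T implies each residual piece (the pieces are WEAKER-or-equal). -/
theorem lowResidual3Side_of_walkHardFJLinOdd (B : ℕ → ℕ)
    (hT : Summit.QuantumAdvantage.QuantumAdvantage.Theses.CharDial.WalkHardFJLinOdd) : LowResidual3Side B :=
  ((walkHardFJLinOdd_iff_residual3_split B).mp hT).1

end BlockResidual2

end Summit.QuantumAdvantage.AdviceFreeQNC0.JLinPeel.Tower
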